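import Summits.KontsevichZagierPeriods.KontsevichZagierPeriods.Theorems.SymplecticScissorsRealOnePeriodRelationsStubHwLoopsFamily
import Literature.NumberTheory.Transcendental.CurvePeriodsPuncturedLineProofs
import Literature.NumberTheory.Transcendental.CurvePeriodsGmBakerProofs

/-!
# `RealOnePeriodRelations` (stmt-KontsevichZagierPeriods-10042), line `nash-retraction-thin-strip`,
# log–loop layer (reshape 6): stub `stub_hwLogsLoopsFamily`

HUBER–WÜSTHOLZ, THEOREM 13.3 (2), FOR ARBITRARY PATHS ON THE PUNCTURED LINES `Z_a`, ON `𝔾ₘ` AND ON `𝔸¹`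
TOGETHER WITH CLOSED PATHS ON AN ARBITRARY FINITE FAMILY OF ELLIPTIC CURVES `E_{L i}` OVER `ℚ̄` (complex
multiplication and isogenies allowed) — from the isotypic splitting with logarithms (the hypothesis `hSplit`,
= the conclusion of the neighbouring stub `stub_logsIsotypicSplitting`: a vanishing algebraic combination
`α + Σ_j μ_j y_j + Σ_i (a_iω₁⁽ⁱ⁾ + b_iω₂⁽ⁱ⁾ + c_iη₁⁽ⁱ⁾ + d_iη₂⁽ⁱ⁾)` with `ℚ`-independent logarithms `y_j` of algebraic
numbers has `α = 0`, all `μ_j = 0` and vanishing isogeny-class blocks).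

* `hwMulGroupLoopsFamily_of_split` — the sub-diagram `{E_{L i}}ᵢ ∪ {𝔾ₘ, 𝔸¹}` with closed paths on the curves:
  every symbol is `Σ_i loopPart (L i) (A i) (B i) + d · ℓ(M) + e · 𝟙` modulo the relations
  (`Ell.exists_loop_normalForm`, `exists_logSym_rel`); with a `ℚ`-basis `m` of the logarithms
  (`exists_linearIndependent`, `span_logSym_sum`) the subtracted element
  `W = Σ_i loopPart_i + Σ_l D_l ℓ(m_l) + e_tot 𝟙` has vanishing period
  `Σ_i (2(A_i0ω₁ + A_i1ω₂) − 2(B_i0η₁ + B_i1η₂)) + Σ_l D_l m_l + e_tot`; the splitting gives `e_tot = 0`, `D = 0`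
  and vanishing isogeny-class blocks; the class blocks are in the span (`LoopLayer.span_loopPart_class`,
  one isogeny class at a time by `huberWustholzCurvePeriods_of_isogenousEllipticLoops`) and are reassembled by
  `LoopLayer.sum_eq_sum_classes` — the proofs of `CurvePeriods.huberWustholzCurvePeriods_of_ellipticLoops` and
  `LoopLayer.stub_hwLoopsFamily`, joined.
* `stub_hwLogsLoopsFamily` — punctured-line symbols are first transferred to `𝔾ₘ` and `𝟙`
  (`exists_transfer_puncturedLine`, `span_of_transfer_finsupp`).

[cite: HuberWustholz2022, Thm 13.3 (2), §13.2, Thm 15.3 (1),(3), §15.2.2, Rem. 15.11]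
[cite: Masser1975, Ch. III Thm. III]
-/

noncomputable section

open scoped BigOperators
open MvPolynomial Complex
open Literature.NumberTheory.Transcendental Literature.NumberTheory.Transcendental.CurvePeriods

namespace Summit.KontsevichZagierPeriods.SymplecticScissors.RealOnePeriodRelations.LogLoopLayer

/-! ### Closed paths on the family, with `𝔾ₘ` and `𝔸¹` -/

/-- **Huber–Wüstholz 13.3 (2) for closed paths on an arbitrary finite family of elliptic curves over `ℚ̄`
together with arbitrary paths on `𝔾ₘ` and `𝔸¹`**, from the isotypic splitting with logarithms `hSplit`:
normal forms symbol by symbol (`Ell.exists_loop_normalForm` on the curve carrying it, `exists_logSym_rel`),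
a `ℚ`-basis of the logarithms (`span_logSym_sum`), the vanishing of the period of the normal form, the
splitting, and the class-by-class span (`LoopLayer.span_loopPart_class`, `LoopLayer.sum_eq_sum_classes`).
[cite: HuberWustholz2022, Thm 13.3 (2), §13.2, Thm 15.3 (1),(3), Rem. 15.11] -/
theorem hwMulGroupLoopsFamily_of_split
    (hSplit : ∀ (k : ℕ) (L : Fin k → PeriodPair),
      (∀ i, IsAlgebraic ℚ (L i).g₂ ∧ IsAlgebraic ℚ (L i).g₃) →
      ∀ (ι : Type) [Fintype ι] (y : ι → ℂ), (∀ j, IsAlgebraic ℚ (Complex.exp (y j))) → LinearIndependent ℚ y →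
      ∀ (α : ℂ) (μ : ι → ℂ) (a b c d : Fin k → ℂ), IsAlgebraic ℚ α → (∀ j, IsAlgebraic ℚ (μ j)) →
        (∀ i, IsAlgebraic ℚ (a i) ∧ IsAlgebraic ℚ (b i) ∧ IsAlgebraic ℚ (c i) ∧ IsAlgebraic ℚ (d i)) →
        α + ∑ j, μ j * y j + ∑ i, (a i * (L i).ω₁ + b i * (L i).ω₂ + c i * (L i).η₁ + d i * (L i).η₂) = 0 →
          α = 0 ∧ (∀ j, μ j = 0) ∧
            ∀ (i : Fin k) (S : Finset (Fin k)), (∀ j, j ∈ S ↔ (L i).IsIsogenousTo (L j)) →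
              ∑ j ∈ S, (a j * (L j).ω₁ + b j * (L j).ω₂ + c j * (L j).η₁ + d j * (L j).η₂) = 0)
    {k : ℕ} (L : Fin k → PeriodPair) (hL : ∀ i, IsAlgebraic ℚ (L i).g₂ ∧ IsAlgebraic ℚ (L i).g₃)
    (c : PeriodSymbol →₀ ℂ) (hc : ∀ s, IsAlgebraic ℚ (c s))
    (hsupp : ∀ s ∈ c.support,
      (∃ i, s.Z = Ell.curve (L i) ∧ s.γ.toFun 1 = s.γ.toFun 0) ∨
        s.Z = (⟨2, 1, ![X 0 * X 1 - 1]⟩ : CurveData) ∨ s.Z = CurveData.affineLine)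
    (h0 : evalCombination c = 0) : (∃ (kk : ℕ) (ρρ : Fin kk → (PeriodSymbol →₀ ℂ)) (aa : Fin kk → ℂ),
      (∀ l, IsElementaryRelation (ρρ l)) ∧ (∀ l, IsAlgebraic ℚ (aa l)) ∧
        (c) = ∑ l, aa l • ρρ l) := by
  classical
  obtain ⟨E00, hE00⟩ := exists_expPath (L₀ := 0) (L₁ := 0) isAlgebraic_exp_zero isAlgebraic_exp_zero
  have halg0 : ∀ (i : Fin k) (j : Fin 2), IsAlgebraic ℚ ((0 : Fin k → Fin 2 → ℂ) i j) :=
    fun _ _ => isAlgebraic_zero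
  have hLP0 : ∑ i, Ell.loopPart (L i) (hL i).1 (hL i).2 ((0 : Fin k → Fin 2 → ℂ) i)
      ((0 : Fin k → Fin 2 → ℂ) i) = 0 :=
    Finset.sum_eq_zero fun i _ => Ell.loopPart_zero (L i) (hL i).1 (hL i).2
  -- Step 1: every symbol of `c` is `Σ_i loopPart (L i) (Ac i) (Bc i) + d ℓ(M) + e 𝟙` modulo relations
  have key : ∀ s : PeriodSymbol, ∃ (Ac Bc : Fin k → Fin 2 → ℂ) (M : ℂ)
      (E : CurvePath (⟨2, 1, ![X 0 * X 1 - 1]⟩ : CurveData)) (d e : ℂ), s ∈ c.support →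
      ((∀ i j, IsAlgebraic ℚ (Ac i j)) ∧ (∀ i j, IsAlgebraic ℚ (Bc i j)) ∧ IsAlgebraic ℚ (exp M) ∧
        (∀ t, E.toFun t = ![exp ((1 - t) * 0 + t * M), exp (-((1 - t) * 0 + t * M))]) ∧
        IsAlgebraic ℚ d ∧ IsAlgebraic ℚ e ∧
        (∃ (kk : ℕ) (ρρ : Fin kk → (PeriodSymbol →₀ ℂ)) (aa : Fin kk → ℂ),
      (∀ l, IsElementaryRelation (ρρ l)) ∧ (∀ l, IsAlgebraic ℚ (aa l)) ∧
        (Finsupp.single s (1 : ℂ) - ∑ i, Ell.loopPart (L i) (hL i).1 (hL i).2 (Ac i) (Bc i) -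
          d • Finsupp.single (
              (⟨⟨2, 1, ![X 0 * X 1 - 1]⟩, isSmoothAffineCurve_mulGroup, ![X 1, 0], hasAlgCoeffs_ydx, E⟩ : PeriodSymbol)) (1 : ℂ) -
          e • Finsupp.single PeriodSymbol.unit (1 : ℂ)) = ∑ l, aa l • ρρ l)) := by
    intro s
    by_cases hs : s ∈ c.support
    · rcases hsupp s hs with ⟨i, hsZ, hcl⟩ | hGA
      · obtain ⟨Z, hZ, ω, hω, γ⟩ := s
        dsimp only at hsZ hcl
        subst hsZ
        obtain rfl : hZ = Ell.smooth (L i) (hL i).1 (hL i).2 := rfl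
        obtain ⟨A, B, e, hA, hB, he, hrel⟩ :=
          Ell.exists_loop_normalForm (L i) (hL i).1 (hL i).2 γ hcl ω hω
        have hsingle : ∀ {F : Fin 2 → ℂ}, (∀ j, IsAlgebraic ℚ (F j)) →
            ∀ i' j, IsAlgebraic ℚ ((Pi.single i F : Fin k → Fin 2 → ℂ) i' j) := by
          intro F hF i' j
          by_cases h : i' = i
          · subst h
            simpa using hF j
          · simp [h, isAlgebraic_zero]
        have hsum1 : ∑ i', Ell.loopPart (L i') (hL i').1 (hL i').2
            ((Pi.single i A : Fin k → Fin 2 → ℂ) i') ((Pi.single i B : Fin k → Fin 2 → ℂ) i') =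
            Ell.loopPart (L i) (hL i).1 (hL i).2 A B := by
          rw [Finset.sum_eq_single i (fun i' _ hi' => by simp [hi', Ell.loopPart_zero])
            (fun h => (h (Finset.mem_univ i)).elim)]
          simp
        refine ⟨Pi.single i A, Pi.single i B, 0, E00, 0, e, fun _ =>
          ⟨hsingle hA, hsingle hB, isAlgebraic_exp_zero, hE00, isAlgebraic_zero, he, ?_⟩⟩
        obtain ⟨n, ρ, cf, hρ, hcf, hsum⟩ := hrel
        exact ⟨n, ρ, cf, hρ, hcf, by rw [hsum1, zero_smul, sub_zero, ← hsum]⟩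
      · obtain ⟨M, E, d, e, h1, h2, h3, h4, h5⟩ := exists_logSym_rel s hGA
        refine ⟨0, 0, M, E, d, e, fun _ => ⟨halg0, halg0, h1, h2, h3, h4, ?_⟩⟩
        obtain ⟨n, ρ, cf, hρ, hcf, hsum⟩ := h5
        exact ⟨n, ρ, cf, hρ, hcf, by rw [hLP0, sub_zero, ← hsum]⟩
    · exact ⟨0, 0, 0, E00, 0, 0, fun h => (hs h).elim⟩
  choose Ac Bc M E d e hkey using key
  -- Step 2: a `ℚ`-basis of the `ℚ`-span of the logarithms `M_s`
  set S : Finset ℂ := c.support.image M with hS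
  obtain ⟨b, hbS, hspan, hli⟩ := exists_linearIndependent ℚ (↑S : Set ℂ)
  have hbfin : b.Finite := S.finite_toSet.subset hbS
  set Bs : Finset ℂ := hbfin.toFinset with hBs
  have hBb : (↑Bs : Set ℂ) = b := hbfin.coe_toFinset
  have halgB : ∀ m : Bs, IsAlgebraic ℚ (exp (m : ℂ)) := by
    rintro ⟨m, hm⟩
    have hm' : m ∈ S := by
      have : m ∈ b := by rw [← hBb]; exact hm
      exact hbS this
    obtain ⟨s, hs, rfl⟩ := Finset.mem_image.1 hm'
    exact (hkey s hs).2.2.1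
  have hliB : LinearIndependent ℚ (fun m : Bs => (m : ℂ)) := by
    rw [← hBb] at hli
    exact hli
  have keyB : ∀ m : Bs, ∃ Em : CurvePath (⟨2, 1, ![X 0 * X 1 - 1]⟩ : CurveData),
      ∀ t, Em.toFun t = ![exp ((1 - t) * 0 + t * (m : ℂ)), exp (-((1 - t) * 0 + t * (m : ℂ)))] :=
    fun m => exists_expPath (L₀ := 0) (L₁ := (m : ℂ)) isAlgebraic_exp_zero (halgB m)
  choose Em hEm using keyB
  -- Step 3: rational coordinates of each `M_s` in the basis
  have keyq : ∀ s : PeriodSymbol, ∃ q : Bs → ℚ, s ∈ c.support →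
      ∑ i, (q i : ℂ) * (i : ℂ) = M s := by
    intro s
    by_cases hs : s ∈ c.support
    · have hmem : M s ∈ Submodule.span ℚ (Set.range fun m : Bs => (m : ℂ)) := by
        have hrange : Set.range (fun m : Bs => (m : ℂ)) = (↑Bs : Set ℂ) := Subtype.range_coe
        rw [hrange, hBb, hspan]
        exact Submodule.subset_span (Finset.mem_coe.2 (Finset.mem_image_of_mem M hs))
      obtain ⟨q, hq⟩ := (Submodule.mem_span_range_iff_exists_fun ℚ).1 hmem
      refine ⟨q, fun _ => ?_⟩
      rw [← hq]
      exact Finset.sum_congr rfl fun i _ => by rw [Rat.smul_def]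
    · exact ⟨0, fun h => (hs h).elim⟩
  choose q hq using keyq
  -- Step 4: per symbol, `s ∼ Σ_i loopPart_i + Σ_l (d_s q_{s,l}) ℓ(l) + e_s 𝟙`
  have hper_s : ∀ s ∈ c.support, (∃ (kk : ℕ) (ρρ : Fin kk → (PeriodSymbol →₀ ℂ)) (aa : Fin kk → ℂ),
      (∀ l, IsElementaryRelation (ρρ l)) ∧ (∀ l, IsAlgebraic ℚ (aa l)) ∧
        (Finsupp.single s (1 : ℂ) -
      ∑ i, Ell.loopPart (L i) (hL i).1 (hL i).2 (Ac s i) (Bc s i) -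
      d s • ∑ l : Bs, (q s l : ℂ) • Finsupp.single (
          (⟨⟨2, 1, ![X 0 * X 1 - 1]⟩, isSmoothAffineCurve_mulGroup, ![X 1, 0], hasAlgCoeffs_ydx, Em l⟩ : PeriodSymbol)) (1 : ℂ) -
      e s • Finsupp.single PeriodSymbol.unit (1 : ℂ)) = ∑ l, aa l • ρρ l) := by
    intro s hs
    obtain ⟨_, _, _, hEs, hds, _, hrel⟩ := hkey s hs
    have hsum := span_logSym_sum (Finset.univ : Finset Bs) (fun m : Bs => (m : ℂ)) halgB (q s) Em
      (fun i t => hEm i t) (E s) (fun t => by rw [hEs, hq s hs])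
    obtain ⟨n, ρ, a, hρ, ha, he⟩ := span_add hrel (span_smul hds hsum)
    exact ⟨n, ρ, a, hρ, ha, by rw [← he, smul_sub]; abel⟩
  -- Step 5: sum over the support
  have hspan : ∀ T : Finset PeriodSymbol, T ⊆ c.support →
      (∃ (kk : ℕ) (ρρ : Fin kk → (PeriodSymbol →₀ ℂ)) (aa : Fin kk → ℂ),
      (∀ l, IsElementaryRelation (ρρ l)) ∧ (∀ l, IsAlgebraic ℚ (aa l)) ∧
        (∑ s ∈ T, c s • (Finsupp.single s (1 : ℂ) -
        ∑ i, Ell.loopPart (L i) (hL i).1 (hL i).2 (Ac s i) (Bc s i) -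
        d s • ∑ l : Bs, (q s l : ℂ) • Finsupp.single (
            (⟨⟨2, 1, ![X 0 * X 1 - 1]⟩, isSmoothAffineCurve_mulGroup, ![X 1, 0], hasAlgCoeffs_ydx, Em l⟩ : PeriodSymbol)) (1 : ℂ) -
        e s • Finsupp.single PeriodSymbol.unit (1 : ℂ))) = ∑ l, aa l • ρρ l) := by
    intro T hT
    induction T using Finset.induction_on with
    | empty => simpa using span_zero
    | insert s T hs ih =>
      rw [Finset.sum_insert hs]
      exact span_add (span_smul (hc s) (hper_s s (hT (Finset.mem_insert_self s T))))
        (ih (subset_trans (Finset.subset_insert s T) hT))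
  obtain ⟨n, ρ, a, hρ, ha, hmain⟩ := hspan c.support subset_rfl
  -- the subtracted element `W = Σ_i loopPart_i (Atot i) (Btot i) + Σ_l D_l ℓ(l) + e_tot 𝟙`
  set Atot : Fin k → Fin 2 → ℂ := fun i => ∑ s ∈ c.support, c s • Ac s i with hAtot
  set Btot : Fin k → Fin 2 → ℂ := fun i => ∑ s ∈ c.support, c s • Bc s i with hBtot
  set D : Bs → ℂ := fun l => ∑ s ∈ c.support, c s * d s * (q s l : ℂ) with hD
  set etot : ℂ := ∑ s ∈ c.support, c s * e s with hetot
  have hc_eq : c = ∑ s ∈ c.support, c s • Finsupp.single s (1 : ℂ) := by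
    conv_lhs => rw [← Finsupp.sum_single c]
    simp only [Finsupp.sum, Finsupp.smul_single_one]
  have hLPsum : ∑ s ∈ c.support, c s • ∑ i, Ell.loopPart (L i) (hL i).1 (hL i).2 (Ac s i) (Bc s i) =
      ∑ i, Ell.loopPart (L i) (hL i).1 (hL i).2 (Atot i) (Btot i) := by
    simp only [Finset.smul_sum, Ell.smul_loopPart]
    rw [Finset.sum_comm]
    exact Finset.sum_congr rfl fun i _ => Ell.loopPart_finset_sum (L i) (hL i).1 (hL i).2 _ _ _
  have hLogsum : ∑ s ∈ c.support, c s • (d s • ∑ l : Bs, (q s l : ℂ) • Finsupp.single (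
      (⟨⟨2, 1, ![X 0 * X 1 - 1]⟩, isSmoothAffineCurve_mulGroup, ![X 1, 0], hasAlgCoeffs_ydx, Em l⟩ : PeriodSymbol)) (1 : ℂ)) =
      ∑ l : Bs, D l • Finsupp.single (
          (⟨⟨2, 1, ![X 0 * X 1 - 1]⟩, isSmoothAffineCurve_mulGroup, ![X 1, 0], hasAlgCoeffs_ydx, Em l⟩ : PeriodSymbol)) (1 : ℂ) := by
    simp only [Finset.smul_sum, smul_smul, hD, Finset.sum_smul]
    rw [Finset.sum_comm]
    simp only [mul_assoc]
  have hUnitsum : ∑ s ∈ c.support, c s • (e s • Finsupp.single PeriodSymbol.unit (1 : ℂ)) =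
      etot • Finsupp.single PeriodSymbol.unit (1 : ℂ) := by
    simp only [smul_smul, hetot, Finset.sum_smul]
  have hident : ∑ s ∈ c.support, c s • (Finsupp.single s (1 : ℂ) -
        ∑ i, Ell.loopPart (L i) (hL i).1 (hL i).2 (Ac s i) (Bc s i) -
        d s • ∑ l : Bs, (q s l : ℂ) • Finsupp.single (
            (⟨⟨2, 1, ![X 0 * X 1 - 1]⟩, isSmoothAffineCurve_mulGroup, ![X 1, 0], hasAlgCoeffs_ydx, Em l⟩ : PeriodSymbol)) (1 : ℂ) -
        e s • Finsupp.single PeriodSymbol.unit (1 : ℂ)) =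
      c - (∑ i, Ell.loopPart (L i) (hL i).1 (hL i).2 (Atot i) (Btot i) +
        ∑ l : Bs, D l • Finsupp.single (
            (⟨⟨2, 1, ![X 0 * X 1 - 1]⟩, isSmoothAffineCurve_mulGroup, ![X 1, 0], hasAlgCoeffs_ydx, Em l⟩ : PeriodSymbol)) (1 : ℂ) +
        etot • Finsupp.single PeriodSymbol.unit (1 : ℂ)) := by
    simp only [smul_sub, Finset.sum_sub_distrib]
    rw [← hc_eq, hLPsum, hLogsum, hUnitsum]
    abel
  rw [hident] at hmain
  -- Step 6: the period of `W` vanishes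
  have hevW : etot + ∑ l : Bs, D l * (l : ℂ) +
      ∑ i, (2 * Atot i 0 * (L i).ω₁ + 2 * Atot i 1 * (L i).ω₂ + -2 * Btot i 0 * (L i).η₁ +
        -2 * Btot i 1 * (L i).η₂) = 0 := by
    have h1 := evalCombination_eq_zero_of_isElementaryRelation ρ a hρ
    rw [← hmain, sub_eq_add_neg, evalCombination_add, h0, zero_add, ← neg_one_smul ℂ,
      evalCombination_smul, evalCombination_add, evalCombination_add, evalCombination_finsetSum,
      evalCombination_finsetSum, evalCombination_smul, evalCombination_single, period_unit,
      neg_one_mul, neg_eq_zero] at h1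
    simp only [Ell.evalCombination_loopPart] at h1
    have h2 : ∀ l : Bs, evalCombination (D l • Finsupp.single (
        (⟨⟨2, 1, ![X 0 * X 1 - 1]⟩, isSmoothAffineCurve_mulGroup, ![X 1, 0], hasAlgCoeffs_ydx, Em l⟩ : PeriodSymbol)) (1 : ℂ)) =
        D l * (l : ℂ) := fun l => by
      rw [evalCombination_smul, evalCombination_single, period_ydx_expPath 0 (l : ℂ) (Em l)
        (hEm l), sub_zero, one_mul]
    simp_rw [h2] at h1
    rw [← h1]
    have e3 : ∑ i, (2 * Atot i 0 * (L i).ω₁ + 2 * Atot i 1 * (L i).ω₂ + -2 * Btot i 0 * (L i).η₁ +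
        -2 * Btot i 1 * (L i).η₂) = ∑ i, (2 * (Atot i 0 * (L i).ω₁ + Atot i 1 * (L i).ω₂) -
        2 * (Btot i 0 * (L i).η₁ + Btot i 1 * (L i).η₂)) :=
      Finset.sum_congr rfl fun i _ => by ring
    rw [e3]
    ring
  -- Step 7: the isotypic splitting with logarithms
  have hqalg : ∀ s (l : Bs), IsAlgebraic ℚ ((q s l : ℚ) : ℂ) := fun s l => by
    simpa using isAlgebraic_algebraMap (R := ℚ) (A := ℂ) (q s l)
  have hDalg : ∀ l, IsAlgebraic ℚ (D l) := fun l =>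
    isAlgebraic_finsetSum _ _ fun s hs => ((hc s).mul (hkey s hs).2.2.2.2.1).mul (hqalg s l)
  have hetalg : IsAlgebraic ℚ etot :=
    isAlgebraic_finsetSum _ _ fun s hs => (hc s).mul (hkey s hs).2.2.2.2.2.1
  have hAalg : ∀ i j, IsAlgebraic ℚ (Atot i j) := fun i j => by
    rw [hAtot]
    beta_reduce
    rw [Finset.sum_apply]
    exact isAlgebraic_finsetSum _ _ fun s hs => (hc s).mul ((hkey s hs).1 i j)
  have hBalg : ∀ i j, IsAlgebraic ℚ (Btot i j) := fun i j => by
    rw [hBtot]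
    beta_reduce
    rw [Finset.sum_apply]
    exact isAlgebraic_finsetSum _ _ fun s hs => (hc s).mul ((hkey s hs).2.1 i j)
  have h2alg : IsAlgebraic ℚ (2 : ℂ) := isAlgebraic_nat 2
  obtain ⟨het0, hD0, hblock⟩ := hSplit k L hL Bs (fun m : Bs => (m : ℂ)) halgB hliB etot D
    (fun i => 2 * Atot i 0) (fun i => 2 * Atot i 1) (fun i => -2 * Btot i 0) (fun i => -2 * Btot i 1)
    hetalg hDalg
    (fun i => ⟨h2alg.mul (hAalg i 0), h2alg.mul (hAalg i 1), h2alg.neg.mul (hBalg i 0), h2alg.neg.mul (hBalg i 1)⟩)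
    hevW
  -- Step 8: the isogeny classes and their blocks
  set Scl : Fin k → Finset (Fin k) := fun i => Finset.univ.filter fun j => (L i).IsIsogenousTo (L j)
    with hScl
  have hSmem : ∀ i j, j ∈ Scl i ↔ (L i).IsIsogenousTo (L j) := fun i j => by simp [hScl]
  have hclassSpan : ∀ i, (∃ (kk : ℕ) (ρρ : Fin kk → (PeriodSymbol →₀ ℂ)) (aa : Fin kk → ℂ),
      (∀ l, IsElementaryRelation (ρρ l)) ∧ (∀ l, IsAlgebraic ℚ (aa l)) ∧
        (∑ j ∈ Scl i, Ell.loopPart (L j) (hL j).1 (hL j).2 (Atot j) (Btot j)) = ∑ l, aa l • ρρ l) := by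
    intro i
    refine LoopLayer.span_loopPart_class L hL (L i) (hL i).1 (hL i).2 (Scl i)
      (fun j hj => ((hSmem i j).1 hj).symm) Atot Btot hAalg hBalg ?_
    rw [← hblock i (Scl i) (hSmem i)]
    exact Finset.sum_congr rfl fun j _ => by ring
  have hrefl : ∀ i, i ∈ Scl i := fun i => (hSmem i i).2 (PeriodPair.isIsogenousTo_refl _)
  have hclass : ∀ i j, j ∈ Scl i → Scl j = Scl i := fun i j hj => by
    have hij := (hSmem i j).1 hj
    ext l
    rw [hSmem, hSmem]
    exact ⟨fun h => hij.trans h, fun h => hij.symm.trans h⟩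
  have hLPspan : (∃ (kk : ℕ) (ρρ : Fin kk → (PeriodSymbol →₀ ℂ)) (aa : Fin kk → ℂ),
      (∀ l, IsElementaryRelation (ρρ l)) ∧ (∀ l, IsAlgebraic ℚ (aa l)) ∧
        (∑ j, Ell.loopPart (L j) (hL j).1 (hL j).2 (Atot j) (Btot j)) = ∑ l, aa l • ρρ l) := by
    rw [LoopLayer.sum_eq_sum_classes Scl hrefl hclass
      fun j => Ell.loopPart (L j) (hL j).1 (hL j).2 (Atot j) (Btot j)]
    exact span_finsetSum _ _ fun i _ => span_smul (isAlgebraic_nat _).inv (hclassSpan i)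
  -- Step 9: conclude
  obtain ⟨n', ρ', cf', hρ', hcf', hfin⟩ := span_add ⟨n, ρ, a, hρ, ha, hmain⟩ hLPspan
  refine ⟨n', ρ', cf', hρ', hcf', ?_⟩
  rw [← hfin]
  simp only [hD0, het0, zero_smul, Finset.sum_const_zero, add_zero, sub_add_cancel]

/-! ### The stub: punctured lines transferred to `𝔾ₘ` and `𝟙` -/

/-- **Stub `stub_hwLogsLoopsFamily`** — HUBER–WÜSTHOLZ 13.3 (2) FOR ARBITRARY PATHS ON THE PUNCTURED LINES `Z_a`, `𝔾ₘ`,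
`𝔸¹` TOGETHER WITH CLOSED PATHS ON AN ARBITRARY FINITE FAMILY OF ELLIPTIC CURVES OVER `ℚ̄` (CM and isogenies allowed),
from the isotypic splitting with logarithms: punctured-line symbols are transferred to `𝔾ₘ` and `𝟙`
(`exists_transfer_puncturedLine`, `span_of_transfer_finsupp`), then `hwMulGroupLoopsFamily_of_split`.
[cite: HuberWustholz2022, Thm 13.3 (2), §13.2, Thm 15.3 (1),(3), Rem. 15.11] -/
theorem stub_hwLogsLoopsFamily :
    (∀ (k : ℕ) (L : Fin k → PeriodPair),
      (∀ i, IsAlgebraic ℚ (L i).g₂ ∧ IsAlgebraic ℚ (L i).g₃) →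
      ∀ (ι : Type) [Fintype ι] (y : ι → ℂ), (∀ j, IsAlgebraic ℚ (Complex.exp (y j))) → LinearIndependent ℚ y →
      ∀ (α : ℂ) (μ : ι → ℂ) (a b c d : Fin k → ℂ), IsAlgebraic ℚ α → (∀ j, IsAlgebraic ℚ (μ j)) →
        (∀ i, IsAlgebraic ℚ (a i) ∧ IsAlgebraic ℚ (b i) ∧ IsAlgebraic ℚ (c i) ∧ IsAlgebraic ℚ (d i)) →
        α + ∑ j, μ j * y j + ∑ i, (a i * (L i).ω₁ + b i * (L i).ω₂ + c i * (L i).η₁ + d i * (L i).η₂) = 0 →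
          α = 0 ∧ (∀ j, μ j = 0) ∧
            ∀ (i : Fin k) (S : Finset (Fin k)), (∀ j, j ∈ S ↔ (L i).IsIsogenousTo (L j)) →
              ∑ j ∈ S, (a j * (L j).ω₁ + b j * (L j).ω₂ + c j * (L j).η₁ + d j * (L j).η₂) = 0) →
    ∀ (k : ℕ) (L : Fin k → PeriodPair),
    (∀ i, IsAlgebraic ℚ (L i).g₂ ∧ IsAlgebraic ℚ (L i).g₃) →
    ∀ (c : PeriodSymbol →₀ ℂ), (∀ s, IsAlgebraic ℚ (c s)) →
    (∀ s ∈ c.support,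
      (∃ i, s.Z = Ell.curve (L i) ∧ s.γ.toFun 1 = s.γ.toFun 0) ∨
      (∃ (r : ℕ) (a : Fin r → ℂ), Function.Injective a ∧ (∀ i, IsAlgebraic ℚ (a i)) ∧
        s.Z = (⟨2, 1, ![X 1 * ∏ i, (X 0 - C (a i)) - 1]⟩ : CurveData)) ∨
        s.Z = (⟨2, 1, ![X 0 * X 1 - 1]⟩ : CurveData) ∨ s.Z = CurveData.affineLine) →
    evalCombination c = 0 →
    ∃ (n : ℕ) (ρ : Fin n → (PeriodSymbol →₀ ℂ)) (a : Fin n → ℂ),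
      (∀ l, IsElementaryRelation (ρ l)) ∧ (∀ l, IsAlgebraic ℚ (a l)) ∧ c = ∑ l, a l • ρ l := by
  intro hSplit k L hL c hc hsupp h0
  classical
  have key : ∀ s : PeriodSymbol, ∃ V : PeriodSymbol →₀ ℂ, s ∈ c.support →
      ((∀ t, IsAlgebraic ℚ (V t)) ∧ (∃ (kk : ℕ) (ρρ : Fin kk → (PeriodSymbol →₀ ℂ)) (aa : Fin kk → ℂ),
      (∀ l, IsElementaryRelation (ρρ l)) ∧ (∀ l, IsAlgebraic ℚ (aa l)) ∧
        (Finsupp.single s 1 - V) = ∑ l, aa l • ρρ l) ∧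
        (∀ t ∈ V.support,
          (∃ i, t.Z = Ell.curve (L i) ∧ t.γ.toFun 1 = t.γ.toFun 0) ∨
            t.Z = (⟨2, 1, ![X 0 * X 1 - 1]⟩ : CurveData) ∨ t.Z = CurveData.affineLine)) := by
    intro s
    by_cases hs : s ∈ c.support
    · rcases hsupp s hs with hloop | ⟨r, a, hinj, ha, hsZ⟩ | hrest
      · exact ⟨Finsupp.single s 1, fun _ => ⟨fun t => isAlgebraic_single_one_apply _ _,
          by rw [sub_self]; exact span_zero, fun t ht => by
            have h3 := (Finsupp.mem_support_single _ _ _).1 ht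
            rw [h3.1]
            exact Or.inl hloop⟩⟩
      · obtain ⟨Z, hZ, ω, hω, γ⟩ := s
        dsimp only at hsZ
        subst hsZ
        obtain rfl : hZ = isSmoothAffineCurve_puncturedLine ha := rfl
        obtain ⟨cf, γ', e, hcf, he, hrel⟩ := exists_transfer_puncturedLine ha hinj ω hω γ
        refine ⟨∑ i, cf i • Finsupp.single (⟨⟨2, 1, ![X 0 * X 1 - 1]⟩,
            isSmoothAffineCurve_mulGroup, ![X 1, 0], hasAlgCoeffs_ydx, γ' i⟩ : PeriodSymbol)
            (1 : ℂ) + e • Finsupp.single PeriodSymbol.unit (1 : ℂ), fun _ => ⟨?_, ?_, ?_⟩⟩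
        · intro t
          rw [Finsupp.add_apply, Finsupp.finsetSum_apply, Finsupp.smul_apply, smul_eq_mul]
          refine (isAlgebraic_finsetSum _ _ fun i _ => ?_).add
            (he.mul (isAlgebraic_single_one_apply _ _))
          rw [Finsupp.smul_apply, smul_eq_mul]
          exact (hcf i).mul (isAlgebraic_single_one_apply _ _)
        · obtain ⟨n, ρ, b, hρ, hb, hsum⟩ := hrel
          exact ⟨n, ρ, b, hρ, hb, by rw [← hsum]; abel⟩
        · intro t ht
          rcases Finset.mem_union.1 (Finsupp.support_add ht) with h1 | h2
          · obtain ⟨i, _, hi⟩ := Finset.mem_biUnion.1 (Finsupp.support_finsetSum h1)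
            have h3 := (Finsupp.mem_support_single _ _ _).1 (Finsupp.support_smul hi)
            exact Or.inr (Or.inl (by rw [h3.1]))
          · have h3 := (Finsupp.mem_support_single _ _ _).1 (Finsupp.support_smul h2)
            exact Or.inr (Or.inr (by rw [h3.1]; rfl))
      · exact ⟨Finsupp.single s 1, fun _ => ⟨fun t => isAlgebraic_single_one_apply _ _,
          by rw [sub_self]; exact span_zero, fun t ht => by
            have h3 := (Finsupp.mem_support_single _ _ _).1 ht
            rw [h3.1]
            exact Or.inr hrest⟩⟩
    · exact ⟨0, fun h => (hs h).elim⟩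
  choose V hV using key
  exact span_of_transfer_finsupp c hc V (fun s hs => (hV s hs).1) (fun s hs => (hV s hs).2.1)
    (fun t => (∃ i, t.Z = Ell.curve (L i) ∧ t.γ.toFun 1 = t.γ.toFun 0) ∨
      t.Z = (⟨2, 1, ![X 0 * X 1 - 1]⟩ : CurveData) ∨ t.Z = CurveData.affineLine)
    (fun s hs => (hV s hs).2.2)
    (fun c' hc' hsupp' h0' => hwMulGroupLoopsFamily_of_split hSplit L hL c' hc' hsupp' h0')
    h0

end Summit.KontsevichZagierPeriods.SymplecticScissors.RealOnePeriodRelations.LogLoopLayer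

end
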